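import Literature.IUT.HodgeTheaters.ThetaHodgeTheatersRemarksA
import Literature.IUT.HodgeTheaters.InitialThetaData
import HarnessLib

/-!
# [IUTchI] Remark 3.1.3: the shape record `ThetaDataShape` is inhabited (by the genuine Def. 3.1 data),
# and its two "completely determined by" predicates are contentful (NV-L5, proof-only)

S. Mochizuki, *Inter-universal Teichmüller theory I*, §3, Remark 3.1.3, kurims manuscript (May 2020)
p. 65 [claim: Mochizuki2012, status: disputed]: "the data `(F/F̄, X_F, l, C_K, V, V^bad_mod, ε)` is, in
fact, completely determined by the data `(F/F̄, X_F, C_K, V, V^bad_mod)`, and … `C_K` is completely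
determined up to `K`-isomorphism by the data `(F/F̄, X_F, l, V)`."

The tree types the Remark over the SHAPE record `Literature.IUT.HodgeTheaters.ThetaDataShape 𝔽 𝕏 𝕃 ℭ 𝕍 𝔅 𝔈`
(abc-iut-L5 lineage, `ThetaHodgeTheatersRemarksA.lean`) with the two predicates `DeterminedByFive Adm`
and `CKDeterminedUpToIso Adm KIso` on an admissibility condition `Adm`.  This PROOF-ONLY file (0 `def`s;
NV-L5 row `ThetaDataShape`, L5-lead RULINGS #27) records:

* `nonempty_iff` — the record is inhabited iff its seven component types are (`_parameterRecord`);
* `exists_shape_of_initialThetaData` (`_model`) — every GENUINE initial Θ-datum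
  `D : InitialThetaData F K Fbar E l P` ([IUTchI] Def. 3.1, abc-iut-L5-t2) yields a shape whose seven
  entries ARE its data in the tree's typing: `F ⊆ F̄` as the subfield `F ⊆ Fbar`, `X_F` as the curve `E`,
  `l`, `C_K` as the `ThetaGeometry` datum `D.geom` (Def. 3.1 (b)(d)(f)), `V̲ = D.V`, `V^bad_mod = D.VbadMod`,
  and `ε̲` as the §1 datum `D.geom.pe` that carries the cusps (the shape's slots are abstract types; this
  is the honest instantiation available in the tree — said, not hidden);
* `determinedByFive_of_eq`, `ckDeterminedUpToIso_of_eq` — the typed predicates HOLD for any admissibility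
  condition that pins `l` and `ε` (resp. `C_K`) as functions of the remaining entries — the logical shape
  of print's "it follows immediately from Definition 3.1, (d), (e), (f)";
* `exists_adm_not_determinedByFive`, `exists_adm_not_ckDeterminedUpToIso` — they FAIL for the vacuous
  admissibility condition (`_parameterRecord`, two-element slots), so neither is a tautology of the
  record: each is a genuine constraint on `Adm`, as print intends.

Nothing of the series is asserted; no side is taken on [IUTchIII] Cor. 3.12; instantiated ≠ endorsed.
-/

namespace Literature.IUT.HodgeTheaters

namespace ThetaDataShape

universe u v w

/-! ### Inhabitation -/

/-- **NV-L5 `ThetaDataShape` (`_parameterRecord`).**  The shape record of Rmk 3.1.3 is inhabited exactly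
when each of its seven slots is. ([IUTchI] Rmk 3.1.3 p.65) [claim: Mochizuki2012, status: disputed] -/
theorem nonempty_iff {𝔽 𝕏 𝕃 ℭ 𝕍 𝔅 𝔈 : Type*} :
    Nonempty (ThetaDataShape 𝔽 𝕏 𝕃 ℭ 𝕍 𝔅 𝔈) ↔
      Nonempty 𝔽 ∧ Nonempty 𝕏 ∧ Nonempty 𝕃 ∧ Nonempty ℭ ∧ Nonempty 𝕍 ∧ Nonempty 𝔅 ∧ Nonempty 𝔈 :=
  ⟨fun ⟨S⟩ => ⟨⟨S.F⟩, ⟨S.XF⟩, ⟨S.l⟩, ⟨S.CK⟩, ⟨S.V⟩, ⟨S.VbadMod⟩, ⟨S.eps⟩⟩,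
    fun ⟨⟨a⟩, ⟨b⟩, ⟨c⟩, ⟨d⟩, ⟨e⟩, ⟨f⟩, ⟨g⟩⟩ => ⟨⟨a, b, c, d, e, f, g⟩⟩⟩

section Model

open NumberField

variable {F : Type u} {K : Type v} {Fbar : Type w} [Field F] [NumberField F] [Field K]
  [NumberField K] [Algebra F K] [Field Fbar] [Algebra F Fbar] [Algebra K Fbar]
  {E : WeierstrassCurve F} [E.IsElliptic] {l : ℕ} {P : BadPlacePredicates K}

/-- **NV-L5 `ThetaDataShape` (`_model`).**  Every genuine initial Θ-datum `D` of [IUTchI] Def. 3.1 (the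
tree's `InitialThetaData F K Fbar E l P`) yields a 7-tuple of the shape `(F/F̄, X_F, l, C_K, V, V^bad_mod, ε)`
whose entries are `D`'s own data: `F ⊆ F̄` := the image of `F` in `Fbar`, `X_F` := the curve `E`
(`X_F = E ∖ {O}`), `l`, `C_K` := the `ThetaGeometry` datum `D.geom`, `V̲ := D.V`, `V^bad_mod := D.VbadMod`,
`ε̲` := the §1 datum `D.geom.pe` carrying the cusps. ([IUTchI] Rmk 3.1.3 p.65)
[claim: Mochizuki2012, status: disputed] -/
theorem exists_shape_of_initialThetaData (D : InitialThetaData F K Fbar E l P) :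
    ∃ S : ThetaDataShape (Subfield Fbar) (WeierstrassCurve F) ℕ
        (ThetaGeometry (Fbar ≃ₐ[F] Fbar) (galoisSubgroupOf F K Fbar) l) (Set (Val K))
        (Set (FinitePlace (fieldOfModuli E))) PuncturedEllipticData.{w},
      S.F = (algebraMap F Fbar).fieldRange ∧ S.XF = E ∧ S.l = l ∧ S.CK = D.geom ∧ S.V = D.V ∧
        S.VbadMod = D.VbadMod ∧ S.eps = D.geom.pe :=
  ⟨⟨(algebraMap F Fbar).fieldRange, E, l, D.geom, D.V, D.VbadMod, D.geom.pe⟩,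
    rfl, rfl, rfl, rfl, rfl, rfl, rfl⟩

/-- Hence the shape record over these genuine slot types is inhabited as soon as an initial Θ-datum is
given (`_model`). ([IUTchI] Rmk 3.1.3 p.65) [claim: Mochizuki2012, status: disputed] -/
theorem nonempty_model (D : InitialThetaData F K Fbar E l P) :
    Nonempty (ThetaDataShape (Subfield Fbar) (WeierstrassCurve F) ℕ
      (ThetaGeometry (Fbar ≃ₐ[F] Fbar) (galoisSubgroupOf F K Fbar) l) (Set (Val K))
      (Set (FinitePlace (fieldOfModuli E))) PuncturedEllipticData.{w}) :=
  let ⟨S, _⟩ := exists_shape_of_initialThetaData D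
  ⟨S⟩

end Model

/-! ### The two "completely determined by" predicates are contentful -/

variable {𝔽 𝕏 𝕃 ℭ 𝕍 𝔅 𝔈 : Type*}

/-- **`DeterminedByFive` holds whenever admissibility pins `l` and `ε` as functions of the other five
entries** — the logical shape of Rmk 3.1.3's "it follows immediately from Definition 3.1, (d), (e), (f)"
(`l` is read off the type `(1, l-tors)±` of `C_K`; `ε` is prescribed by (f)).
([IUTchI] Rmk 3.1.3 p.65) [claim: Mochizuki2012, status: disputed] -/
theorem determinedByFive_of_eq (Adm : ThetaDataShape 𝔽 𝕏 𝕃 ℭ 𝕍 𝔅 𝔈 → Prop)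
    (fl : 𝔽 → 𝕏 → ℭ → 𝕍 → 𝔅 → 𝕃) (fe : 𝔽 → 𝕏 → ℭ → 𝕍 → 𝔅 → 𝔈)
    (hl : ∀ S, Adm S → S.l = fl S.F S.XF S.CK S.V S.VbadMod)
    (he : ∀ S, Adm S → S.eps = fe S.F S.XF S.CK S.V S.VbadMod) : DeterminedByFive Adm := by
  rw [determinedByFive_iff]
  intro D D' hD hD' h1 h2 h3 h4 h5
  cases D; cases D'
  simp only at h1 h2 h3 h4 h5
  subst h1 h2 h3 h4 h5
  have hl' := (hl _ hD).trans (hl _ hD').symm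
  have he' := (he _ hD).trans (he _ hD').symm
  simp only at hl' he'
  subst hl' he'
  rfl

/-- **`CKDeterminedUpToIso` holds (for any reflexive `KIso`) whenever admissibility pins `C_K` as a
function of `(F/F̄, X_F, l, V)`** — Rmk 3.1.3's second claim in its logical shape (`C_K := C_F ×_F K`
with `K` determined by `X_F[l]`). ([IUTchI] Rmk 3.1.3 p.65) [claim: Mochizuki2012, status: disputed] -/
theorem ckDeterminedUpToIso_of_eq (Adm : ThetaDataShape 𝔽 𝕏 𝕃 ℭ 𝕍 𝔅 𝔈 → Prop) (KIso : ℭ → ℭ → Prop)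
    (hrefl : ∀ c, KIso c c) (fc : 𝔽 → 𝕏 → 𝕃 → 𝕍 → ℭ)
    (hc : ∀ S, Adm S → S.CK = fc S.F S.XF S.l S.V) : CKDeterminedUpToIso Adm KIso := by
  intro D D' hD hD' h1 h2 h3 h4
  rw [hc D hD, hc D' hD', h1, h2, h3, h4]
  exact hrefl _

/-- **`DeterminedByFive` is NOT a tautology of the record**: for the vacuous admissibility condition on
shapes with a two-element `l`-slot, two admissible tuples agree on the five entries and differ in `l`
(`_parameterRecord`). ([IUTchI] Rmk 3.1.3 p.65) [claim: Mochizuki2012, status: disputed] -/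
theorem exists_adm_not_determinedByFive :
    ∃ Adm : ThetaDataShape Unit Unit Bool Unit Unit Unit Unit → Prop, ¬ DeterminedByFive Adm := by
  refine ⟨fun _ => True, fun h => ?_⟩
  rw [determinedByFive_iff] at h
  have := h ⟨(), (), true, (), (), (), ()⟩ ⟨(), (), false, (), (), (), ()⟩ trivial trivial
    rfl rfl rfl rfl rfl
  cases this

/-- **`CKDeterminedUpToIso` is NOT a tautology of the record** (with `KIso := Eq`): for the vacuous
admissibility condition on shapes with a two-element `C_K`-slot, two admissible tuples agree on
`(F/F̄, X_F, l, V)` and have non-isomorphic (`≠`) `C_K` (`_parameterRecord`). ([IUTchI] Rmk 3.1.3 p.65)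
[claim: Mochizuki2012, status: disputed] -/
theorem exists_adm_not_ckDeterminedUpToIso :
    ∃ Adm : ThetaDataShape Unit Unit Unit Bool Unit Unit Unit → Prop, ¬ CKDeterminedUpToIso Adm Eq := by
  refine ⟨fun _ => True, fun h => ?_⟩
  have := h ⟨(), (), (), true, (), (), ()⟩ ⟨(), (), (), false, (), (), ()⟩ trivial trivial rfl rfl rfl rfl
  cases this

/-- Both predicates are satisfiable AND refutable on the same record type, i.e. each is exactly as strong
as the admissibility condition makes it (`_parameterRecord`). ([IUTchI] Rmk 3.1.3 p.65)
[claim: Mochizuki2012, status: disputed] -/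
theorem predicates_contentful :
    ((∃ Adm : ThetaDataShape Unit Unit Bool Unit Unit Unit Unit → Prop, DeterminedByFive Adm) ∧
      ∃ Adm : ThetaDataShape Unit Unit Bool Unit Unit Unit Unit → Prop, ¬ DeterminedByFive Adm) ∧
    ((∃ Adm : ThetaDataShape Unit Unit Unit Bool Unit Unit Unit → Prop, CKDeterminedUpToIso Adm Eq) ∧
      ∃ Adm : ThetaDataShape Unit Unit Unit Bool Unit Unit Unit → Prop, ¬ CKDeterminedUpToIso Adm Eq) :=
  ⟨⟨⟨fun S => S.l = true ∧ S.eps = (),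
      determinedByFive_of_eq _ (fun _ _ _ _ _ => true) (fun _ _ _ _ _ => ()) (fun _ h => h.1) (fun _ h => h.2)⟩,
     exists_adm_not_determinedByFive⟩,
   ⟨⟨fun S => S.CK = true, ckDeterminedUpToIso_of_eq _ Eq (fun _ => rfl) (fun _ _ _ _ => true) (fun _ h => h)⟩,
     exists_adm_not_ckDeterminedUpToIso⟩⟩

end ThetaDataShape

end Literature.IUT.HodgeTheaters
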